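import Summits.CriticalPhenomena.Ising3DConformalLimit.Theorems.PerfectScreeningSubharmonicOffOriginKlBandDefs

/-!
# Crux `PerfectScreening.SubharmonicOffOrigin` (stmt-CriticalPhenomena-1341), line
`kl-band-positivity`: stub `stub_bandSubharmonic` (the BAND LEMMA)

This file proves the registered stub `stub_bandSubharmonic : Sig.stub_bandSubharmonic` of the
checked skeleton of the line `kl-band-positivity` (objects and signatures in
`PerfectScreeningSubharmonicOffOriginKlBandDefs`): given the layer-kernel facts
`Sig.stub_layerKernel`, ANY function `G : ℤ³ → ℝ` with an iso-mass (Källén–Lehmann) representation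
`G(x) = ∫ u_θ[κ θ](x) dm(θ)` in a direction `i₀` (mass measure `m` carried by `θ ∈ (0,1]`, Markov
fibre kernel `κ`) whose massive fibres have nonnegative first-layer profiles (`FibrePositive`) is
lattice-subharmonic at every site off the source plane:
`6 G(x) ≤ ∑ᵢ (G(x + eᵢ) + G(x − eᵢ))` whenever `x_{i₀} ≠ 0`.

Proof (purely analytic):
* `bandSub_pointwise` / `bandSub_fibre_identity`: the 7-point stencil is DIAGONAL in iso-mass
  variables. For the fibre integrand `λ_θ(k)^{|n|} cos(k·y)` (`n = x_{i₀}`, `y = x̌`), the two axial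
  neighbours contribute `(λ^{|n|+1} + λ^{|n|−1}) cos(k·y)`, the four transverse ones
  `λ^{|n|} cos(k·y) (4 − k̂²)` (`cos(φ+kⱼ) + cos(φ−kⱼ) = 2cos φ cos kⱼ`), so the stencil multiplies
  the integrand by `λ + 1/λ − 2 − k̂² = (1−θ)²/θ` (the quadratic `layerSymbol_quadratic`); by
  linearity of `∫ · d(κ θ)`, `(Δu_θ)(x) = ((1−θ)²/θ)·u_θ(x)` for every `θ > 0`.
* `bandSub_fibre_nonneg`: for a massive rate `θ ∈ (0,1)`, `λ_θ^{|n|−1} = ∑_z P(z)cos(k·z)` with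
  `P ≥ 0` summable (hypothesis `Sig.stub_layerKernel`), hence
  `u_θ(x) = ½ ∑_z P(z) (w_θ(z+y) + w_θ(z−y)) ≥ 0` by first-layer positivity (`w_θ = layerOne`;
  sum and integral exchanged by dominated convergence against the finite fibre measure).
* `stub_bandSubharmonic`: `∑_{x'∼x} G(x') − 6G(x) = ∫ (Δu_θ)(x) dm(θ)` (linearity,
  `IsoMassRep.integrable`) and the integrand is `((1−θ)²/θ)·u_θ(x) ≥ 0` for `m`-a.e. `θ`
  (`θ ∈ (0,1]` a.e. by `IsoMassRep.window`; at the massless fibre `θ = 1` the weight vanishes).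

References: the Helmholtz structure of transfer-matrix fibres is classical (Glimm–Jaffe,
*Quantum Physics* (1987) §6.1; Aizenman–Duminil-Copin, Ann. of Math. 194 (2021) Prop. 5.3);
everything used here is elementary measure theory from Mathlib.
-/

noncomputable section

open MeasureTheory ProbabilityTheory
open Literature.Probability.LatticeModels

namespace Summit.CriticalPhenomena.Ising3DConformalLimit.Theorems.PerfectScreening.KlBand

/-! ## Elementary facts about the layer symbol -/

/-- `k ↦ k̂²(k)` is continuous. -/
theorem bandSub_continuous_khatSq : Continuous khatSq := by
  unfold khatSq; fun_prop

/-- `k ↦ k·w` is continuous. -/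
theorem bandSub_continuous_phase (w : Fin 2 → ℤ) : Continuous fun k : Fin 2 → ℝ => phase k w := by
  unfold phase; fun_prop

/-- The denominator `B + √(B² − 4θ²)` of the layer symbol is positive for `θ ≥ 0`. -/
theorem bandSub_layerSymbol_den_pos {θ : ℝ} (hθ : 0 ≤ θ) (k : Fin 2 → ℝ) :
    0 < (1 + θ ^ 2 + θ * khatSq k) + Real.sqrt ((1 + θ ^ 2 + θ * khatSq k) ^ 2 - 4 * θ ^ 2) := by
  have h1 : 0 ≤ θ * khatSq k := mul_nonneg hθ (khatSq_nonneg k)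
  have h2 := Real.sqrt_nonneg ((1 + θ ^ 2 + θ * khatSq k) ^ 2 - 4 * θ ^ 2)
  have h3 := sq_nonneg θ
  linarith

/-- `k ↦ λ_θ(k)` is continuous for `θ ≥ 0`. -/
theorem bandSub_continuous_layerSymbol {θ : ℝ} (hθ : 0 ≤ θ) : Continuous (layerSymbol θ) := by
  have hk := bandSub_continuous_khatSq
  unfold layerSymbol
  exact continuous_const.div (by fun_prop) fun k => (bandSub_layerSymbol_den_pos hθ k).ne'

/-- `λ_θ(k) ≥ 0` for `θ ≥ 0`. -/
theorem bandSub_layerSymbol_nonneg {θ : ℝ} (hθ : 0 ≤ θ) (k : Fin 2 → ℝ) : 0 ≤ layerSymbol θ k := by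
  unfold layerSymbol
  exact div_nonneg (by linarith) (bandSub_layerSymbol_den_pos hθ k).le

/-- `λ_θ(k) ≤ 1` for `θ ≥ 0` (`B ≥ 1 + θ² ≥ 2θ`). -/
theorem bandSub_layerSymbol_le_one {θ : ℝ} (hθ : 0 ≤ θ) (k : Fin 2 → ℝ) : layerSymbol θ k ≤ 1 := by
  unfold layerSymbol
  rw [div_le_one (bandSub_layerSymbol_den_pos hθ k)]
  have h1 : 0 ≤ θ * khatSq k := mul_nonneg hθ (khatSq_nonneg k)
  have h2 := Real.sqrt_nonneg ((1 + θ ^ 2 + θ * khatSq k) ^ 2 - 4 * θ ^ 2)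
  nlinarith [sq_nonneg (1 - θ)]

/-- `|λ_θ(k)ⁿ| ≤ 1` for `θ ≥ 0`. -/
theorem bandSub_abs_layerSymbol_pow_le {θ : ℝ} (hθ : 0 ≤ θ) (k : Fin 2 → ℝ) (n : ℕ) :
    |layerSymbol θ k ^ n| ≤ 1 := by
  rw [abs_pow]
  exact pow_le_one₀ (abs_nonneg _)
    (abs_le.2 ⟨by linarith [bandSub_layerSymbol_nonneg hθ k], bandSub_layerSymbol_le_one hθ k⟩)

/-- The basic fibre integrands `λ_θ(k)ⁿ cos(k·w)` are integrable against any finite fibre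
measure. -/
theorem bandSub_integrable {θ : ℝ} (hθ : 0 ≤ θ) (ν : Measure (Fin 2 → ℝ)) [IsFiniteMeasure ν]
    (n : ℕ) (w : Fin 2 → ℤ) :
    Integrable (fun k => layerSymbol θ k ^ n * Real.cos (phase k w)) ν := by
  have hc : Continuous fun k => layerSymbol θ k ^ n * Real.cos (phase k w) := by
    have h1 := bandSub_continuous_layerSymbol hθ
    have h2 := bandSub_continuous_phase w
    fun_prop
  refine (integrable_const (1 : ℝ)).mono' hc.aestronglyMeasurable (ae_of_all _ fun k => ?_)
  rw [Real.norm_eq_abs, abs_mul]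
  calc |layerSymbol θ k ^ n| * |Real.cos (phase k w)| ≤ 1 * 1 :=
        mul_le_mul (bandSub_abs_layerSymbol_pow_le hθ k n) (Real.abs_cos_le_one _) (abs_nonneg _)
          zero_le_one
    _ = 1 := one_mul 1

/-! ## Bookkeeping of the 7-point stencil seen from the transfer direction -/

/-- The phase is additive in the lattice argument. -/
theorem bandSub_phase_add (k : Fin 2 → ℝ) (y z : Fin 2 → ℤ) :
    phase k (y + z) = phase k y + phase k z := by
  simp only [phase, Pi.add_apply, Int.cast_add, mul_add, Finset.sum_add_distrib]

/-- The phase is subtractive in the lattice argument. -/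
theorem bandSub_phase_sub (k : Fin 2 → ℝ) (y z : Fin 2 → ℤ) :
    phase k (y - z) = phase k y - phase k z := by
  simp only [phase, Pi.sub_apply, Int.cast_sub, mul_sub, Finset.sum_sub_distrib]

/-- The phase of a transverse unit vector. -/
theorem bandSub_phase_single (k : Fin 2 → ℝ) (j : Fin 2) :
    phase k (Pi.single j 1) = k j := by
  simp [phase, Pi.single_apply]

/-- Axial steps do not move the transverse coordinates. -/
theorem bandSub_perp_add_single_self (i₀ : Fin 3) (x : Site 3) :
    perp i₀ (x + Pi.single i₀ 1) = perp i₀ x := by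
  funext j
  simp [perp]

/-- Axial steps do not move the transverse coordinates. -/
theorem bandSub_perp_sub_single_self (i₀ : Fin 3) (x : Site 3) :
    perp i₀ (x - Pi.single i₀ 1) = perp i₀ x := by
  funext j
  simp [perp]

/-- Transverse steps shift the transverse coordinates by the corresponding unit vector. -/
theorem bandSub_perp_add_single_succAbove (i₀ : Fin 3) (x : Site 3) (j : Fin 2) :
    perp i₀ (x + Pi.single (i₀.succAbove j) 1) = perp i₀ x + Pi.single j 1 := by
  funext j'
  simp [perp, Pi.single_apply]

/-- Transverse steps shift the transverse coordinates by the corresponding unit vector. -/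
theorem bandSub_perp_sub_single_succAbove (i₀ : Fin 3) (x : Site 3) (j : Fin 2) :
    perp i₀ (x - Pi.single (i₀.succAbove j) 1) = perp i₀ x - Pi.single j 1 := by
  funext j'
  simp [perp, Pi.single_apply]

/-- Transverse steps do not move the axial coordinate. -/
theorem bandSub_apply_add_single_succAbove (i₀ : Fin 3) (x : Site 3) (j : Fin 2) :
    (x + Pi.single (i₀.succAbove j) 1 : Site 3) i₀ = x i₀ := by
  simp

/-- Transverse steps do not move the axial coordinate. -/
theorem bandSub_apply_sub_single_succAbove (i₀ : Fin 3) (x : Site 3) (j : Fin 2) :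
    (x - Pi.single (i₀.succAbove j) 1 : Site 3) i₀ = x i₀ := by
  simp

/-- Axial steps move the axial coordinate by `±1`. -/
theorem bandSub_apply_add_single_self (i₀ : Fin 3) (x : Site 3) :
    (x + Pi.single i₀ 1 : Site 3) i₀ = x i₀ + 1 := by
  simp

/-- Axial steps move the axial coordinate by `±1`. -/
theorem bandSub_apply_sub_single_self (i₀ : Fin 3) (x : Site 3) :
    (x - Pi.single i₀ 1 : Site 3) i₀ = x i₀ - 1 := by
  simp

/-! ## The Helmholtz identity of an iso-mass fibre off the source plane -/

/-- **Pointwise Helmholtz identity.** In iso-mass variables the 7-point stencil applied to the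
fibre integrand `λ_θ(k)^{|z_{i₀}|} cos(k·ž)` at a site `x` off the plane `x_{i₀} = 0` multiplies it
by `(1−θ)²/θ`: `λ² − (2 + k̂²)λ + 1 = ((1−θ)²/θ)·λ` (the quadratic `layerSymbol_quadratic`) and
`cos(φ + kⱼ) + cos(φ − kⱼ) = 2cos φ cos kⱼ`, `∑ⱼ 2cos kⱼ = 4 − k̂²`. -/
theorem bandSub_pointwise (i₀ : Fin 3) {θ : ℝ} (hθ : 0 < θ) (x : Site 3) (hx : x i₀ ≠ 0)
    (k : Fin 2 → ℝ) :
    (∑ i : Fin 3, layerSymbol θ k ^ ((x + Pi.single i 1 : Site 3) i₀).natAbs *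
          Real.cos (phase k (perp i₀ (x + Pi.single i 1))) +
        ∑ i : Fin 3, layerSymbol θ k ^ ((x - Pi.single i 1 : Site 3) i₀).natAbs *
          Real.cos (phase k (perp i₀ (x - Pi.single i 1)))) -
      6 * (layerSymbol θ k ^ (x i₀).natAbs * Real.cos (phase k (perp i₀ x))) =
    (1 - θ) ^ 2 / θ * (layerSymbol θ k ^ (x i₀).natAbs * Real.cos (phase k (perp i₀ x))) := by
  obtain ⟨M, hM⟩ : ∃ M, (x i₀).natAbs = M + 1 :=
    Nat.exists_eq_add_one_of_ne_zero (Int.natAbs_ne_zero.mpr hx)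
  have hq := layerSymbol_quadratic θ hθ k
  have hkh : khatSq k = 2 * (1 - Real.cos (k 0)) + 2 * (1 - Real.cos (k 1)) := by
    simp [khatSq]
  have hpm : layerSymbol θ k ^ (x i₀ + 1).natAbs + layerSymbol θ k ^ (x i₀ - 1).natAbs =
      layerSymbol θ k ^ (M + 2) + layerSymbol θ k ^ M := by
    rcases lt_or_gt_of_ne hx with h | h
    · rw [show (x i₀ + 1).natAbs = M by omega, show (x i₀ - 1).natAbs = M + 2 by omega, add_comm]
    · rw [show (x i₀ + 1).natAbs = M + 2 by omega, show (x i₀ - 1).natAbs = M by omega]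
  rw [Fin.sum_univ_succAbove _ i₀, Fin.sum_univ_succAbove _ i₀, Fin.sum_univ_two, Fin.sum_univ_two]
  simp only [bandSub_apply_add_single_self, bandSub_apply_sub_single_self,
    bandSub_apply_add_single_succAbove, bandSub_apply_sub_single_succAbove,
    bandSub_perp_add_single_self, bandSub_perp_sub_single_self,
    bandSub_perp_add_single_succAbove, bandSub_perp_sub_single_succAbove,
    bandSub_phase_add, bandSub_phase_sub, bandSub_phase_single, Real.cos_add, Real.cos_sub, hM]
  rw [hkh] at hq
  rw [div_mul_eq_mul_div, eq_div_iff hθ.ne']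
  linear_combination (Real.cos (phase k (perp i₀ x)) * layerSymbol θ k ^ M) * hq +
    (θ * Real.cos (phase k (perp i₀ x))) * hpm

/-- **Fibrewise Helmholtz identity.** For `θ > 0`, any finite fibre measure `ν` and any site `x`
off the source plane, the lattice Laplacian of the iso-mass fibre `u_θ[ν]` at `x` is
`((1−θ)²/θ)·u_θ[ν](x)` (linearity of `∫ · dν` over the seven stencil points and
`bandSub_pointwise`). -/
theorem bandSub_fibre_identity (i₀ : Fin 3) {θ : ℝ} (hθ : 0 < θ) (ν : Measure (Fin 2 → ℝ))
    [IsFiniteMeasure ν] (x : Site 3) (hx : x i₀ ≠ 0) :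
    ∑ i : Fin 3, (isoMassFun i₀ θ ν (x + Pi.single i 1) + isoMassFun i₀ θ ν (x - Pi.single i 1)) -
        6 * isoMassFun i₀ θ ν x = (1 - θ) ^ 2 / θ * isoMassFun i₀ θ ν x := by
  have hI : ∀ z : Site 3, Integrable
      (fun k => layerSymbol θ k ^ (z i₀).natAbs * Real.cos (phase k (perp i₀ z))) ν :=
    fun z => bandSub_integrable hθ.le ν _ _
  simp only [isoMassFun]
  rw [Finset.sum_add_distrib, ← integral_finsetSum _ fun i _ => hI _,
    ← integral_finsetSum _ fun i _ => hI _, ← integral_const_mul, ← integral_const_mul,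
    ← integral_add (integrable_finsetSum _ fun i _ => hI _)
      (integrable_finsetSum _ fun i _ => hI _),
    ← integral_sub ((integrable_finsetSum _ fun i _ => hI _).fun_add
      (integrable_finsetSum _ fun i _ => hI _)) ((hI x).const_mul 6)]
  exact integral_congr_ae (ae_of_all _ fun k => bandSub_pointwise i₀ hθ x hx k)

/-! ## Sign of a massive fibre off the source plane -/

/-- **Fibre positivity propagates off the first layer.** For a massive rate `θ ∈ (0,1)`, a finite
fibre measure `ν` whose first-layer profile `w_θ[ν]` is nonnegative on `ℤ²`, and a site `x` with
`|x_{i₀}| = M + 1 ≥ 1`: writing `λ_θ^M = ∑_z P(z) cos(k·z)` with `P ≥ 0` summable (the layer-kernel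
stub) and `cos(k·z)cos(k·y) = ½(cos(k·(z+y)) + cos(k·(z−y)))`,
`u_θ[ν](x) = ½ ∑_z P(z) (w_θ(z+y) + w_θ(z−y)) ≥ 0` (the sum and the integral are exchanged by
dominated convergence: `|terms| ≤ P(z)`, `ν` finite). -/
theorem bandSub_fibre_nonneg (hLK : Sig.stub_layerKernel) (i₀ : Fin 3) {θ : ℝ} (hθ0 : 0 < θ)
    (hθ1 : θ < 1) (ν : Measure (Fin 2 → ℝ)) [IsFiniteMeasure ν]
    (hpos : ∀ y, 0 ≤ layerOne θ ν y) (x : Site 3) (hx : x i₀ ≠ 0) :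
    0 ≤ isoMassFun i₀ θ ν x := by
  obtain ⟨M, hM⟩ : ∃ M, (x i₀).natAbs = M + 1 :=
    Nat.exists_eq_add_one_of_ne_zero (Int.natAbs_ne_zero.mpr hx)
  obtain ⟨P, hP0, hPs, hsum⟩ := hLK θ ⟨hθ0, hθ1⟩ M
  unfold isoMassFun
  rw [hM]
  have hLc := bandSub_continuous_layerSymbol hθ0.le
  have hmain : HasSum (fun z => ∫ k, P z * Real.cos (phase k z) *
      (layerSymbol θ k * Real.cos (phase k (perp i₀ x))) ∂ν)
      (∫ k, layerSymbol θ k ^ (M + 1) * Real.cos (phase k (perp i₀ x)) ∂ν) := by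
    refine hasSum_integral_of_dominated_convergence (fun z _ => P z) (fun z => ?_)
      (fun z => ae_of_all _ fun k => ?_) (ae_of_all _ fun _ => hPs) (integrable_const _)
      (ae_of_all _ fun k => ?_)
    · have hc : Continuous fun k => P z * Real.cos (phase k z) *
          (layerSymbol θ k * Real.cos (phase k (perp i₀ x))) := by
        have h1 := bandSub_continuous_phase z
        have h2 := bandSub_continuous_phase (perp i₀ x)
        fun_prop
      exact hc.aestronglyMeasurable
    · rw [Real.norm_eq_abs, abs_mul, abs_mul, abs_mul, abs_of_nonneg (hP0 z)]
      have h1 := Real.abs_cos_le_one (phase k z)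
      have h2 := Real.abs_cos_le_one (phase k (perp i₀ x))
      have h3 : |layerSymbol θ k| ≤ 1 := by
        simpa using bandSub_abs_layerSymbol_pow_le hθ0.le k 1
      have h4 := hP0 z
      calc P z * |Real.cos (phase k z)| * (|layerSymbol θ k| * |Real.cos (phase k (perp i₀ x))|)
          ≤ P z * 1 * (1 * 1) := by gcongr
        _ = P z := by ring
    · have h := (hsum k).mul_right (layerSymbol θ k * Real.cos (phase k (perp i₀ x)))
      have e : layerSymbol θ k ^ M * (layerSymbol θ k * Real.cos (phase k (perp i₀ x))) =
          layerSymbol θ k ^ (M + 1) * Real.cos (phase k (perp i₀ x)) := by ring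
      rw [e] at h
      exact h
  refine hmain.nonneg fun z => ?_
  have hI1 : ∀ w, Integrable (fun k => layerSymbol θ k * Real.cos (phase k w)) ν := fun w => by
    simpa using bandSub_integrable hθ0.le ν 1 w
  have hrw : (fun k => P z * Real.cos (phase k z) *
      (layerSymbol θ k * Real.cos (phase k (perp i₀ x)))) =
      fun k => P z / 2 * (layerSymbol θ k * Real.cos (phase k (z + perp i₀ x)) +
        layerSymbol θ k * Real.cos (phase k (z - perp i₀ x))) := by
    funext k
    rw [bandSub_phase_add, bandSub_phase_sub, Real.cos_add, Real.cos_sub]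
    ring
  rw [hrw, integral_const_mul, integral_add (hI1 _) (hI1 _)]
  have h5 := hpos (z + perp i₀ x)
  have h6 := hpos (z - perp i₀ x)
  unfold layerOne at h5 h6
  have h4 := hP0 z
  positivity

/-! ## The band lemma -/

/-- **Stub 6 of line `kl-band-positivity` (the BAND LEMMA).** Given the layer-kernel facts, any
function `G` on `ℤ³` with an iso-mass representation `G = ∫ u_θ[κ θ] dm(θ)` (`m` carried by
`θ ∈ (0,1]`) whose massive fibres have nonnegative first-layer profiles is lattice-subharmonic at
every site off the source plane: `6 G(x) ≤ ∑_{x' ∼ x} G(x')` for `x_{i₀} ≠ 0`.  Proof: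
`∑_{x'∼x} G(x') − 6G(x) = ∫ (Δu_θ)(x) dm(θ)` (linearity, `IsoMassRep.integrable`), and for `m`-a.e.
`θ`, `(Δu_θ)(x) = ((1−θ)²/θ)·u_θ(x) ≥ 0` by `bandSub_fibre_identity` and `bandSub_fibre_nonneg`
(`θ < 1`; at `θ = 1` the weight vanishes). -/
theorem stub_bandSubharmonic : Sig.stub_bandSubharmonic := by
  intro hLK G i₀ m κ hR hF x hx
  haveI := hR.finite
  haveI := hR.markov
  have hint : ∀ z : Site 3, Integrable (fun θ => isoMassFun i₀ θ (κ θ) z) m := hR.integrable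
  have hae : 0 ≤ᵐ[m] fun θ =>
      (∑ i : Fin 3, (isoMassFun i₀ θ (κ θ) (x + Pi.single i 1) +
        isoMassFun i₀ θ (κ θ) (x - Pi.single i 1))) - 6 * isoMassFun i₀ θ (κ θ) x := by
    have hwin : ∀ᵐ θ ∂m, θ ∈ Set.Ioc (0 : ℝ) 1 := mem_ae_iff.2 hR.window
    filter_upwards [hwin, hF] with θ hθ hFθ
    simp only [Pi.zero_apply]
    rw [bandSub_fibre_identity i₀ hθ.1 (κ θ) x hx]
    rcases eq_or_lt_of_le hθ.2 with h1 | h1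
    · rw [h1]; simp
    · exact mul_nonneg (div_nonneg (sq_nonneg _) hθ.1.le)
        (bandSub_fibre_nonneg hLK i₀ hθ.1 h1 (κ θ) (hFθ h1) x hx)
  have h0 := integral_nonneg_of_ae hae
  rw [integral_sub (integrable_finsetSum _ fun i _ => (hint _).fun_add (hint _))
      ((hint x).const_mul 6),
    integral_finsetSum _ fun i _ => (hint _).fun_add (hint _), integral_const_mul] at h0
  have h2 : ∀ i : Fin 3, ∫ θ, (isoMassFun i₀ θ (κ θ) (x + Pi.single i 1) +
      isoMassFun i₀ θ (κ θ) (x - Pi.single i 1)) ∂m =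
        G (x + Pi.single i 1) + G (x - Pi.single i 1) :=
    fun i => by rw [integral_add (hint _) (hint _), hR.repr, hR.repr]
  simp only [h2, ← hR.repr x] at h0
  linarith

end Summit.CriticalPhenomena.Ising3DConformalLimit.Theorems.PerfectScreening.KlBand

end
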